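import Summits.ValiantsHypothesis.ValiantsHypothesis.Theorems.DefinabilityGapZeroedBlocks
import HarnessLib

/-!
# DefinabilityGap — the pencil of zeroed block permanents: block patterns and coefficients

Route `route-ValiantsHypothesis-DefinabilityGap` (decomp-valiant cycle 1, lens 5: hardness–randomness / PIT axis); size road
of the residual `KIPlantedHitting` (stmt-ValiantsHypothesis-23547; census cells W5 / W19), read-once leaf F4 / W10
(`KIPlantedHittingRO`, stmt-ValiantsHypothesis-23704). `G_m : y ↦ (P_c(y))_c`, `P_c = kiPer m c`; zeroed block permanents
`Q^F_c = kiPerZ m F c` (`DefinabilityGapZeroedBlocks`). First of two files proving that every member of the affine PENCIL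
`C α + ∑_c C (a c) · Q^F_c` spanned by the surviving blocks is prime (`DefinabilityGapPrimePencil`).

* `bpat m c π` — the permutation monomial `∏_i y_{E_c(π i, i)}` of block `c` as an exponent vector on the seed universe
  `𝔽_q × 𝔽_q`: multilinear, `m` cells, all inside `cells m c`;
* `pencil m F a α = C α + ∑_c C (a c) · Q^F_c`; `coeff_bpat_pencil` (`m ≥ 3`): the coefficient of `bpat m c π` is
  `[π avoids the zeros of c] · a c` (no other block contains a permutation monomial of `c`, design intersections `≤ 2`);
  `exists_of_coeff_pencil_ne_zero`: every non-trivial monomial of the pencil is an avoiding permutation monomial of a live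
  block; `degreeOf_pencil_le`: the pencil is multilinear; `exists_of_degreeOf_pencil_ne_zero`: its variables are free cells
  of live blocks.
0 sorry.
-/

noncomputable section

open MvPolynomial
open Literature.Computability.AlgebraicComplexity Literature.Computability.MetaComplexity

namespace Summit.ValiantsHypothesis.ValiantsHypothesis.Theorems.DefinabilityGapPrimePencilPatterns

open Summit.ValiantsHypothesis.ValiantsHypothesis.Theorems.DefinabilityGapAffineRung
open Summit.ValiantsHypothesis.ValiantsHypothesis.Theorems.DefinabilityGapShiftedPrimes
open Summit.ValiantsHypothesis.ValiantsHypothesis.Theorems.DefinabilityGapPatternPermanent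
open Summit.ValiantsHypothesis.ValiantsHypothesis.Theorems.DefinabilityGapZeroedBlocks

variable {m : ℕ}

/-! ## 1. Permutation monomials of a block, in the seed universe -/

/-- The exponent vector of the permutation monomial `∏_i y_{E_c(π i, i)}` of block `c`. [this file] -/
def bpat (m : ℕ) (c : Fin 3 → Fin (qOf m)) (π : Equiv.Perm (Fin m)) : (Fin (qOf m) × Fin (qOf m)) →₀ ℕ :=
  Finsupp.mapDomain (cellEmb m c) (permMonomial π)

/-- Value of a block pattern at a cell of the block. [this file] -/
theorem bpat_apply_cellEmb (c : Fin 3 → Fin (qOf m)) (π : Equiv.Perm (Fin m)) (rc : Fin m × Fin m) :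
    bpat m c π (cellEmb m c rc) = permMonomial π rc :=
  Finsupp.mapDomain_apply (cellEmb m c).injective _ _

/-- A block pattern vanishes outside the cells of the block. [this file] -/
theorem bpat_apply_of_notMem_cells (c : Fin 3 → Fin (qOf m)) (π : Equiv.Perm (Fin m))
    {x : Fin (qOf m) × Fin (qOf m)} (hx : x ∉ cells m c) : bpat m c π x = 0 := by
  apply Finsupp.mapDomain_notin_range
  rintro ⟨rc, rfl⟩
  exact hx (Finset.mem_map_of_mem _ (Finset.mem_univ rc))

/-- Block patterns are multilinear. [this file] -/
theorem bpat_le_one (c : Fin 3 → Fin (qOf m)) (π : Equiv.Perm (Fin m)) (x : Fin (qOf m) × Fin (qOf m)) :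
    bpat m c π x ≤ 1 := by
  by_cases hx : x ∈ cells m c
  · obtain ⟨rc, -, rfl⟩ := Finset.mem_map.1 hx
    rw [bpat_apply_cellEmb]
    obtain ⟨r, i⟩ := rc
    rw [permMonomial_apply]
    split_ifs <;> simp
  · rw [bpat_apply_of_notMem_cells c π hx]
    exact Nat.zero_le _

/-- The support of a block pattern. [this file] -/
theorem support_bpat (c : Fin 3 → Fin (qOf m)) (π : Equiv.Perm (Fin m)) :
    (bpat m c π).support = (permMonomial π).support.map (cellEmb m c) := by
  rw [bpat, Finsupp.mapDomain_support_of_injective (cellEmb m c).injective, Finset.map_eq_image]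

/-- A block pattern has `m` cells. [this file] -/
theorem card_support_bpat (c : Fin 3 → Fin (qOf m)) (π : Equiv.Perm (Fin m)) : (bpat m c π).support.card = m := by
  rw [support_bpat, Finset.card_map, card_support_permMonomial, Fintype.card_fin]

/-- … all inside the block. [this file] -/
theorem support_bpat_subset_cells (c : Fin 3 → Fin (qOf m)) (π : Equiv.Perm (Fin m)) :
    (bpat m c π).support ⊆ cells m c := by
  rw [support_bpat]
  exact Finset.map_subset_map.2 (Finset.subset_univ _)

/-- Block patterns are non-zero (`m ≥ 1`). [this file] -/
theorem bpat_ne_zero (hm : 1 ≤ m) (c : Fin 3 → Fin (qOf m)) (π : Equiv.Perm (Fin m)) : bpat m c π ≠ 0 := by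
  intro h
  have := card_support_bpat c π
  rw [h, Finsupp.support_zero, Finset.card_empty] at this
  omega

/-- The cells of a block pattern read back as matrix positions `(π i, i)`. [this file] -/
theorem exists_eq_cellEmb_of_bpat_ne_zero {c : Fin 3 → Fin (qOf m)} {π : Equiv.Perm (Fin m)}
    {x : Fin (qOf m) × Fin (qOf m)} (hx : bpat m c π x ≠ 0) : ∃ i : Fin m, cellEmb m c (π i, i) = x := by
  have hxs : x ∈ (bpat m c π).support := Finsupp.mem_support_iff.2 hx
  rw [support_bpat] at hxs
  obtain ⟨⟨r, i⟩, hri, rfl⟩ := Finset.mem_map.1 hxs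
  rw [Finsupp.mem_support_iff, permMonomial_apply] at hri
  have hr : π i = r := by
    by_contra hne
    exact hri (if_neg hne)
  exact ⟨i, by rw [hr]⟩

/-! ## 2. The pencil -/

/-- The PENCIL MEMBER `C α + ∑_c C (a c) · Q^F_c` spanned by the zeroed block permanents. [this file] -/
def pencil (m : ℕ) (F : Finset (Fin (qOf m) × Fin (qOf m))) (a : (Fin 3 → Fin (qOf m)) → ℂ) (α : ℂ) :
    MvPolynomial (Fin (qOf m) × Fin (qOf m)) ℂ :=
  C α + ∑ c, C (a c) * kiPerZ m F c

/-- Coefficients of the pencil away from the constant term. [this file] -/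
theorem coeff_pencil_of_ne_zero (F : Finset (Fin (qOf m) × Fin (qOf m))) (a : (Fin 3 → Fin (qOf m)) → ℂ) (α : ℂ)
    {d : (Fin (qOf m) × Fin (qOf m)) →₀ ℕ} (hd : d ≠ 0) :
    coeff d (pencil m F a α) = ∑ c, a c * coeff d (kiPerZ m F c) := by
  rw [pencil, coeff_add, coeff_C, if_neg hd.symm, zero_add, coeff_sum]
  simp only [coeff_C_mul]

/-- The coefficient of a permutation monomial of block `c` in the pencil is `[π avoids the zeros] · a c` (`m ≥ 3`). [this file] -/
theorem coeff_bpat_pencil (hm : 3 ≤ m) (F : Finset (Fin (qOf m) × Fin (qOf m))) (a : (Fin 3 → Fin (qOf m)) → ℂ)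
    (α : ℂ) (c : Fin 3 → Fin (qOf m)) (π : Equiv.Perm (Fin m)) :
    coeff (bpat m c π) (pencil m F a α) = if Avoids (patOf m F c) π then a c else 0 := by
  rw [coeff_pencil_of_ne_zero F a α (bpat_ne_zero (by omega) c π), Finset.sum_eq_single c]
  · rw [bpat, coeff_perm_kiPerZ_self]
    split_ifs <;> simp
  · intro c' _ hc'
    rw [bpat, coeff_perm_kiPerZ_ne hm hc' π F, mul_zero]
  · intro h
    exact absurd (Finset.mem_univ c) h

/-- A non-trivial monomial of the pencil is an avoiding permutation monomial of a live block. [this file] -/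
theorem exists_of_coeff_pencil_ne_zero {F : Finset (Fin (qOf m) × Fin (qOf m))} {a : (Fin 3 → Fin (qOf m)) → ℂ}
    {α : ℂ} {d : (Fin (qOf m) × Fin (qOf m)) →₀ ℕ} (hd : d ≠ 0) (h : coeff d (pencil m F a α) ≠ 0) :
    ∃ (c : Fin 3 → Fin (qOf m)) (π : Equiv.Perm (Fin m)), a c ≠ 0 ∧ Avoids (patOf m F c) π ∧ bpat m c π = d := by
  rw [coeff_pencil_of_ne_zero F a α hd] at h
  obtain ⟨c, -, hc⟩ := Finset.exists_ne_zero_of_sum_ne_zero h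
  have ha : a c ≠ 0 := left_ne_zero_of_mul hc
  have hk : coeff d (kiPerZ m F c) ≠ 0 := right_ne_zero_of_mul hc
  rw [kiPerZ_eq_rename] at hk
  obtain ⟨u, hu, hcu⟩ := coeff_rename_ne_zero _ _ _ hk
  obtain ⟨π, hπ, rfl⟩ := exists_of_coeff_perPat_ne_zero ℂ hcu
  exact ⟨c, π, ha, hπ, hu⟩

/-- The pencil is multilinear. [this file] -/
theorem degreeOf_pencil_le (F : Finset (Fin (qOf m) × Fin (qOf m))) (a : (Fin 3 → Fin (qOf m)) → ℂ) (α : ℂ)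
    (v : Fin (qOf m) × Fin (qOf m)) : degreeOf v (pencil m F a α) ≤ 1 := by
  rw [degreeOf_le_iff]
  intro d hd
  by_cases hd0 : d = 0
  · rw [hd0, Finsupp.zero_apply]
    exact Nat.zero_le _
  obtain ⟨c, π, -, -, rfl⟩ := exists_of_coeff_pencil_ne_zero hd0 (mem_support_iff.1 hd)
  exact bpat_le_one c π v

/-- A pencil member with a live block of small pattern is non-zero (`m ≥ 3`). [this file] -/
theorem pencil_ne_zero (hm : 3 ≤ m) {F : Finset (Fin (qOf m) × Fin (qOf m))} {a : (Fin 3 → Fin (qOf m)) → ℂ} {α : ℂ}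
    {c₀ : Fin 3 → Fin (qOf m)} (hc₀ : a c₀ ≠ 0) (hF : (patOf m F c₀).card + 2 ≤ m) : pencil m F a α ≠ 0 := by
  obtain ⟨π₀, hπ₀⟩ := exists_avoids (patOf m F c₀) (by rwa [Fintype.card_fin])
  intro h0
  have := coeff_bpat_pencil hm F a α c₀ π₀
  rw [h0, coeff_zero, if_pos hπ₀] at this
  exact hc₀ this.symm

/-- A variable of the pencil is a free cell of a live block. [this file] -/
theorem exists_of_degreeOf_pencil_ne_zero {F : Finset (Fin (qOf m) × Fin (qOf m))} {a : (Fin 3 → Fin (qOf m)) → ℂ}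
    {α : ℂ} {v : Fin (qOf m) × Fin (qOf m)} (hv : degreeOf v (pencil m F a α) ≠ 0) :
    ∃ (c : Fin 3 → Fin (qOf m)) (rc : Fin m × Fin m), a c ≠ 0 ∧ rc ∉ patOf m F c ∧ cellEmb m c rc = v := by
  classical
  have h1 : ¬ degreeOf v (pencil m F a α) ≤ 0 := fun h => hv (Nat.eq_zero_of_le_zero h)
  rw [degreeOf_le_iff] at h1
  push Not at h1
  obtain ⟨d, hd, hdv⟩ := h1
  have hd0 : d ≠ 0 := by
    rintro rfl
    simp at hdv
  obtain ⟨c, π, hc, hπ, rfl⟩ := exists_of_coeff_pencil_ne_zero hd0 (mem_support_iff.1 hd)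
  obtain ⟨i, hi⟩ := exists_eq_cellEmb_of_bpat_ne_zero (c := c) (π := π) hdv.ne'
  exact ⟨c, (π i, i), hc, hπ i, hi⟩

end Summit.ValiantsHypothesis.ValiantsHypothesis.Theorems.DefinabilityGapPrimePencilPatterns
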